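/-
  Summits/AtomisticToContinuum/Crystallization/Theorems/OverbindingBudgetAffineFarStraighteningHook.lean

  residual stmt-AtomisticToContinuum-31280 · slot Z · leaf R_aff′ `AffineChartStraightening'` (…FarSlotRecord §1): brick CAPS-2 of the radial
  development (lens-4 g59 memo NODE-g59-RaffDesign §3 R3 (C4), g59 NOTE «two-step»): the SECOND-SHELL HOOK.
  decomp-a2c lens-4 «minimal counterexample / extremal reduction», generation 59.  0 sorry · 0 axiom · no instance · no notation · no option.
-/
import Summits.AtomisticToContinuum.Crystallization.Theorems.OverbindingBudgetAffineFarStraighteningCaps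

/-! # CAPS-2 — the second-shell hook (PROVED)

In the radial development a placed site `j` that reads the new site `k` in its SECOND shell (`w := u_k(j)`, `‖w‖ = √2`, level
`⟪d,w⟫ ≥ ‖d‖/r − fuzz ≥ −fuzz`) must be linked to the chain of placed FIRST-shell neighbours of `k` through a placed common unit-neighbour.
**Square identity** (§1, `decide`): for every second-shell vector `z` of the fcc / hcp two-shell pattern its unit-neighbours in the first shell
contain a SQUARE `z/2 ± q_a, z/2 ± q_b` with `q_a ⊥ q_b ⊥ z`, `‖q_a‖ = ‖q_b‖ = 1/√2` (also for the three tilted hcp vectors).  Hence (§3), by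
Parseval in the orthonormal frame `(z/√2, √2 q_a, √2 q_b)`, the best of the four has level `⟪d,c⟫ = ⟪d,w⟫/2 + m` with `2m ≥ 0` and
`(2m)² ≥ ‖d‖² − ⟪d,w⟫²/2` (`exists_hook_of_twoShell`), and the linear form used by DEV (`hook_level`, valid for any `w`): for `−‖d‖ ≤ ⟪d,w⟫`,
`⟪d,c⟫ ≥ min(⟪d,w⟫/2, ‖d‖/2) + ‖d‖/6` — the hook `c` is placed with margin `≥ ‖d‖/6 ≫ fuzz` whenever `j` is (threshold for `c`: `‖d‖/(2r)`,
for `j`: `‖d‖/r`; numerics g59/raff/hook2.py: true margin `√2/2 − 1/2 = 0.207`).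
* §1 `SecondShellSquareInt`, `secondShellSquareInt_fcc/hcp`, selectors `mem_fcc/hcpSecondShellInt_of_sqNormInt`.
* §2 Parseval for an orthonormal triple of `ℝ³` (`sum_sq_inner_eq_of_orthonormal`), dot products of integer vectors.
* §3 `exists_hook_scaled`, `exists_hook_of_twoShell`, `hook_level`.
-/

namespace Summit.AtomisticToContinuum.Crystallization.Theorems.OverbindingBudgetAffineFarSmoothSplit

open scoped BigOperators RealInnerProductSpace
open Literature.Geometry.DiscreteGeometry (fccTwoShellPattern hcpTwoShellPattern scaledPattern intVec intVec_apply intVec_sub norm_intVec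
  sqNormInt fccInt hcpInt fccSecondShellInt hcpSecondShellInt sqNormInt_fccInt sqNormInt_hcpInt)
open Module (finrank)

/-! ## §1  The square identity (PROVED, by `decide`) -/

/-- Integer dot product on `ℤ³` (coordinates spelled out). [this file] -/
def dotInt (a b : Fin 3 → ℤ) : ℤ := a 0 * b 0 + a 1 * b 1 + a 2 * b 2

/-- The square property: every `z ∈ S₂` (second shell, squared norm `2N`) has first-shell neighbours `ca, z − ca, cb, z − cb ∈ S` at squared
distance `N` from `z`, whose offsets `A = 2ca − z`, `B = 2cb − z` from the centre `z/2` (doubled) satisfy `A ⊥ z`, `B ⊥ z`, `A ⊥ B`,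
`‖A‖² = ‖B‖² = 2N`. [this file] -/
def SecondShellSquareInt (S S₂ : Finset (Fin 3 → ℤ)) (N : ℤ) : Prop :=
  ∀ z ∈ S₂, ∃ ca ∈ S, ∃ cb ∈ S, z - ca ∈ S ∧ z - cb ∈ S ∧
    sqNormInt (ca - z) = N ∧ sqNormInt (cb - z) = N ∧ sqNormInt ((z - ca) - z) = N ∧ sqNormInt ((z - cb) - z) = N ∧
    dotInt (fun i => 2 * ca i - z i) z = 0 ∧ dotInt (fun i => 2 * cb i - z i) z = 0 ∧
    dotInt (fun i => 2 * ca i - z i) (fun i => 2 * cb i - z i) = 0 ∧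
    sqNormInt (fun i => 2 * ca i - z i) = 2 * N ∧ sqNormInt (fun i => 2 * cb i - z i) = 2 * N

/-- **Square identity, FCC** (second shell `(±2,0,0)…` at scale `√2`). [this file] -/
theorem secondShellSquareInt_fcc : SecondShellSquareInt fccInt fccSecondShellInt 2 := by
  unfold SecondShellSquareInt dotInt
  decide

/-- **Square identity, HCP** (second shell `(6,0,0),(0,6,0),(0,0,6),(2,−4,−4),(−4,2,−4),(−4,−4,2)` at scale `√18`). [this file] -/
theorem secondShellSquareInt_hcp : SecondShellSquareInt hcpInt hcpSecondShellInt 18 := by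
  unfold SecondShellSquareInt dotInt
  decide

/-- Second-shell selector, FCC. [this file] -/
theorem mem_fccSecondShellInt_of_sqNormInt : ∀ z ∈ fccInt ∪ fccSecondShellInt, sqNormInt z = 4 → z ∈ fccSecondShellInt := by decide

/-- Second-shell selector, HCP. [this file] -/
theorem mem_hcpSecondShellInt_of_sqNormInt : ∀ z ∈ hcpInt ∪ hcpSecondShellInt, sqNormInt z = 36 → z ∈ hcpSecondShellInt := by decide

/-! ## §2  Parseval for an orthonormal triple; integer dot products (PROVED) -/

/-- **Parseval in `ℝ³`**: for an orthonormal triple `v`, `Σ ⟪x, vᵢ⟫² = ‖x‖²`. [folklore; Mathlib `OrthonormalBasis.sum_sq_inner_left`] -/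
theorem sum_sq_inner_eq_of_orthonormal {v : Fin 3 → EuclideanSpace ℝ (Fin 3)} (hv : Orthonormal ℝ v)
    (x : EuclideanSpace ℝ (Fin 3)) : ∑ i : Fin 3, ⟪x, v i⟫ ^ 2 = ‖x‖ ^ 2 := by
  have hcard : Fintype.card (Fin 3) = finrank ℝ (EuclideanSpace ℝ (Fin 3)) := by
    rw [Fintype.card_fin, finrank_euclideanSpace_fin]
  set b₀ := basisOfOrthonormalOfCardEqFinrank hv hcard with hb₀
  have hcoe : (b₀ : Fin 3 → EuclideanSpace ℝ (Fin 3)) = v := coe_basisOfOrthonormalOfCardEqFinrank hv hcard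
  have hon : Orthonormal ℝ b₀ := by rw [hcoe]; exact hv
  have h := (b₀.toOrthonormalBasis hon).sum_sq_inner_left x
  rw [Module.Basis.coe_toOrthonormalBasis, hcoe] at h
  exact h

/-- The real inner product of two integer vectors is their integer dot product. [folklore] -/
theorem inner_intVec_intVec (a b : Fin 3 → ℤ) : ⟪intVec a, intVec b⟫ = (dotInt a b : ℝ) := by
  unfold dotInt
  simp [EuclideanSpace.inner_eq_star_dotProduct, dotProduct, Fin.sum_univ_three, intVec_apply]
  ring

-- `norm_sq_intVec` / `sqNormInt_cast_nonneg` are landed elsewhere (gate dedup); inlined below.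

/-! ## §3  The hook (PROVED) -/

/-- **Second-shell hook, generic scaled form.**  For a point `w` of squared norm `2` of `scaledPattern (S ∪ S₂) N` (`S` = first shell with the
square property) and any `d`, some unit point `c` of the pattern at distance `1` from `w` has `2⟪d,c⟫ − ⟪d,w⟫ ≥ 0` and
`(2⟪d,c⟫ − ⟪d,w⟫)² ≥ ‖d‖² − ⟪d,w⟫²/2`. [this file] -/
theorem exists_hook_scaled {S S₂ : Finset (Fin 3 → ℤ)} {N : ℕ} (hN : N ≠ 0)
    (hSnorm : ∀ z ∈ S, sqNormInt z = N) (hsecond : ∀ z ∈ S ∪ S₂, sqNormInt z = 2 * N → z ∈ S₂)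
    (hsq : SecondShellSquareInt S S₂ N) {w : EuclideanSpace ℝ (Fin 3)} (hw : w ∈ scaledPattern (S ∪ S₂) N) (hw2 : ‖w‖ ^ 2 = 2)
    (d : EuclideanSpace ℝ (Fin 3)) :
    ∃ c ∈ scaledPattern (S ∪ S₂) N, ‖c‖ = 1 ∧ dist c w = 1 ∧ 0 ≤ 2 * ⟪d, c⟫ - ⟪d, w⟫ ∧
      ‖d‖ ^ 2 - ⟪d, w⟫ ^ 2 / 2 ≤ (2 * ⟪d, c⟫ - ⟪d, w⟫) ^ 2 := by
  have hpos : (0 : ℝ) < Real.sqrt N := by positivity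
  have hNpos : (0 : ℝ) < (N : ℝ) := by exact_mod_cast Nat.pos_of_ne_zero hN
  have hsN : (Real.sqrt N)⁻¹ ^ 2 = (N : ℝ)⁻¹ := by rw [inv_pow, Real.sq_sqrt hNpos.le]
  obtain ⟨z, hz, rfl⟩ := Finset.mem_image.1 hw
  -- `z` is a second-shell vector
  have hz2 : sqNormInt z = 2 * (N : ℤ) := by
    have h : ‖(Real.sqrt N)⁻¹ • intVec z‖ ^ 2 = (N : ℝ)⁻¹ * (sqNormInt z : ℝ) := by
      rw [norm_smul, mul_pow, norm_inv, Real.norm_of_nonneg hpos.le, hsN, norm_intVec,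
        Real.sq_sqrt (show (0 : ℝ) ≤ (sqNormInt z : ℝ) by unfold sqNormInt; push_cast; positivity)]
    rw [hw2, eq_comm, inv_mul_eq_iff_eq_mul₀ hNpos.ne'] at h
    have h' : (sqNormInt z : ℝ) = 2 * (N : ℝ) := by rw [h]; ring
    exact_mod_cast h'
  obtain ⟨ca, hca, cb, hcb, hra, hrb, h1, h2, h3, h4, hoA, hoB, hoAB, hnA, hnB⟩ := hsq z (hsecond z hz hz2)
  -- the orthonormal frame `(w/√2, A/√2, B/√2)` in real coordinates: `U = s•intVec z`, `A = s•intVec (2ca − z)`, `B = s•intVec (2cb − z)`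
  set s : ℝ := (Real.sqrt N)⁻¹ with hs
  set zA : Fin 3 → ℤ := fun i => 2 * ca i - z i with hzA
  set zB : Fin 3 → ℤ := fun i => 2 * cb i - z i with hzB
  have hdot_comm : ∀ a b : Fin 3 → ℤ, dotInt a b = dotInt b a := by intro a b; unfold dotInt; ring
  have hdot_sq : ∀ a : Fin 3 → ℤ, dotInt a a = sqNormInt a := by intro a; unfold dotInt sqNormInt; ring
  have hUU : ⟪intVec z, intVec z⟫ = 2 * (N : ℝ) := by rw [inner_intVec_intVec, hdot_sq]; exact_mod_cast hz2
  have hAA : ⟪intVec zA, intVec zA⟫ = 2 * (N : ℝ) := by rw [inner_intVec_intVec, hdot_sq]; exact_mod_cast hnA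
  have hBB : ⟪intVec zB, intVec zB⟫ = 2 * (N : ℝ) := by rw [inner_intVec_intVec, hdot_sq]; exact_mod_cast hnB
  have hAU : ⟪intVec zA, intVec z⟫ = 0 := by rw [inner_intVec_intVec]; exact_mod_cast hoA
  have hUA : ⟪intVec z, intVec zA⟫ = 0 := by rw [real_inner_comm]; exact hAU
  have hBU : ⟪intVec zB, intVec z⟫ = 0 := by rw [inner_intVec_intVec]; exact_mod_cast hoB
  have hUB : ⟪intVec z, intVec zB⟫ = 0 := by rw [real_inner_comm]; exact hBU
  have hAB : ⟪intVec zA, intVec zB⟫ = 0 := by rw [inner_intVec_intVec]; exact_mod_cast hoAB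
  have hBA : ⟪intVec zB, intVec zA⟫ = 0 := by rw [real_inner_comm]; exact hAB
  -- orthonormality of `v = ![U/√2, A/√2, B/√2]`
  set c2 : ℝ := (Real.sqrt 2)⁻¹ with hc2
  have hc2sq : c2 ^ 2 = 2⁻¹ := by rw [hc2, inv_pow, Real.sq_sqrt (by norm_num)]
  have hdiag : c2 * (s * (c2 * (s * (2 * (N : ℝ))))) = 1 := by
    rw [show c2 * (s * (c2 * (s * (2 * (N : ℝ))))) = c2 ^ 2 * s ^ 2 * (2 * N) by ring, hc2sq, hsN]
    field_simp
  let v : Fin 3 → EuclideanSpace ℝ (Fin 3) := ![c2 • (s • intVec z), c2 • (s • intVec zA), c2 • (s • intVec zB)]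
  have hv : Orthonormal ℝ v := by
    rw [orthonormal_iff_ite]
    intro i j
    fin_cases i <;> fin_cases j <;>
      simp only [v, Matrix.cons_val_zero, Matrix.cons_val_one, Matrix.head_cons, Matrix.cons_val_two, Matrix.tail_cons,
        real_inner_smul_left, real_inner_smul_right, hUU, hAA, hBB, hAU, hUA, hBU, hUB, hAB, hBA, Fin.isValue, Fin.zero_eta,
        Fin.mk_one, Fin.reduceFinMk, if_true, Fin.reduceEq, if_false, mul_zero] <;>
      exact hdiag
  -- Parseval: `⟪d,U⟫²/2 + ⟪d,A⟫²/2 + ⟪d,B⟫²/2 = ‖d‖²`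
  have hpars := sum_sq_inner_eq_of_orthonormal hv d
  simp only [v, Fin.sum_univ_three, Matrix.cons_val_zero, Matrix.cons_val_one, Matrix.head_cons, Matrix.cons_val_two,
    Matrix.tail_cons, real_inner_smul_right, mul_pow, hc2sq] at hpars
  -- levels: `ℓ(ca) = (ℓ_w + ⟪d,A⟫)/2`, `ℓ(z − ca) = (ℓ_w − ⟪d,A⟫)/2`, etc.
  have hA_eq : s • intVec zA = (2 : ℝ) • (s • intVec ca) - s • intVec z := by
    rw [hzA]; ext i; simp [intVec_apply]; ring
  have hB_eq : s • intVec zB = (2 : ℝ) • (s • intVec cb) - s • intVec z := by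
    rw [hzB]; ext i; simp [intVec_apply]; ring
  have hra_eq : s • intVec (z - ca) = s • intVec z - s • intVec ca := by rw [← intVec_sub, smul_sub]
  have hrb_eq : s • intVec (z - cb) = s • intVec z - s • intVec cb := by rw [← intVec_sub, smul_sub]
  have hℓA : ⟪d, s • intVec zA⟫ = 2 * ⟪d, s • intVec ca⟫ - ⟪d, s • intVec z⟫ := by
    rw [hA_eq, inner_sub_right, real_inner_smul_right]
  have hℓB : ⟪d, s • intVec zB⟫ = 2 * ⟪d, s • intVec cb⟫ - ⟪d, s • intVec z⟫ := by
    rw [hB_eq, inner_sub_right, real_inner_smul_right]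
  have hℓra : ⟪d, s • intVec (z - ca)⟫ = ⟪d, s • intVec z⟫ - ⟪d, s • intVec ca⟫ := by rw [hra_eq, inner_sub_right]
  have hℓrb : ⟪d, s • intVec (z - cb)⟫ = ⟪d, s • intVec z⟫ - ⟪d, s • intVec cb⟫ := by rw [hrb_eq, inner_sub_right]
  -- membership / unit norm / adjacency of the four candidates
  have hmem : ∀ c ∈ S, s • intVec c ∈ scaledPattern (S ∪ S₂) N := fun c hc =>
    Finset.mem_image_of_mem _ (Finset.mem_union_left _ hc)
  have hunit : ∀ c ∈ S, ‖s • intVec c‖ = 1 := fun c hc => norm_scaled_eq_one hN (hSnorm c hc)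
  have hadj : ∀ c : Fin 3 → ℤ, sqNormInt (c - z) = N → dist (s • intVec c) (s • intVec z) = 1 := fun c hc => dist_scaled_eq_one hN hc
  -- choose the best of the four: the sign of `⟪d,A⟫` picks `ca` or `z − ca`; compare `|⟪d,A⟫|` with `|⟪d,B⟫|`
  have hpars2 : ⟪d, s • intVec zA⟫ ^ 2 + ⟪d, s • intVec zB⟫ ^ 2 = 2 * ‖d‖ ^ 2 - ⟪d, s • intVec z⟫ ^ 2 := by
    simp only [real_inner_smul_right]
    linear_combination 2 * hpars
  have key : ∀ (c : Fin 3 → ℤ) (t : ℝ), c ∈ S → sqNormInt (c - z) = N → 2 * ⟪d, s • intVec c⟫ - ⟪d, s • intVec z⟫ = t → 0 ≤ t →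
      ⟪d, s • intVec zA⟫ ^ 2 ≤ t ^ 2 → ⟪d, s • intVec zB⟫ ^ 2 ≤ t ^ 2 →
      ∃ c' ∈ scaledPattern (S ∪ S₂) N, ‖c'‖ = 1 ∧ dist c' (s • intVec z) = 1 ∧ 0 ≤ 2 * ⟪d, c'⟫ - ⟪d, s • intVec z⟫ ∧
        ‖d‖ ^ 2 - ⟪d, s • intVec z⟫ ^ 2 / 2 ≤ (2 * ⟪d, c'⟫ - ⟪d, s • intVec z⟫) ^ 2 := by
    intro c t hc hcz ht ht0 hat hbt
    refine ⟨_, hmem c hc, hunit c hc, hadj c hcz, by rw [ht]; exact ht0, ?_⟩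
    rw [ht]
    linarith [hpars2]
  by_cases hab : ⟪d, s • intVec zB⟫ ^ 2 ≤ ⟪d, s • intVec zA⟫ ^ 2
  · by_cases ha : 0 ≤ ⟪d, s • intVec zA⟫
    · exact key ca _ hca h1 hℓA.symm ha le_rfl hab
    · exact key (z - ca) (-⟪d, s • intVec zA⟫) hra h3 (by rw [hℓra, hℓA]; ring) (by linarith) (by rw [neg_sq])
        (by rw [neg_sq]; exact hab)
  · push Not at hab
    by_cases hb : 0 ≤ ⟪d, s • intVec zB⟫
    · exact key cb _ hcb h2 hℓB.symm hb hab.le le_rfl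
    · exact key (z - cb) (-⟪d, s • intVec zB⟫) hrb h4 (by rw [hℓrb, hℓB]; ring) (by linarith) (by rw [neg_sq]; exact hab.le)
        (by rw [neg_sq])

/-- **SECOND-SHELL HOOK** for the two-shell patterns: for `w ∈ P` with `‖w‖² = 2` and any `d`, some unit `c ∈ P` with `dist c w = 1` has
`2⟪d,c⟫ − ⟪d,w⟫ ≥ 0` and `(2⟪d,c⟫ − ⟪d,w⟫)² ≥ ‖d‖² − ⟪d,w⟫²/2`. [this file] -/
theorem exists_hook_of_twoShell {P : Finset (EuclideanSpace ℝ (Fin 3))} (hP : P = fccTwoShellPattern ∨ P = hcpTwoShellPattern)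
    {w : EuclideanSpace ℝ (Fin 3)} (hw : w ∈ P) (hw2 : ‖w‖ ^ 2 = 2) (d : EuclideanSpace ℝ (Fin 3)) :
    ∃ c ∈ P, ‖c‖ = 1 ∧ dist c w = 1 ∧ 0 ≤ 2 * ⟪d, c⟫ - ⟪d, w⟫ ∧ ‖d‖ ^ 2 - ⟪d, w⟫ ^ 2 / 2 ≤ (2 * ⟪d, c⟫ - ⟪d, w⟫) ^ 2 := by
  rcases hP with rfl | rfl
  · have hS : ∀ z ∈ fccInt, sqNormInt z = ((2 : ℕ) : ℤ) := sqNormInt_fccInt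
    exact exists_hook_scaled two_ne_zero hS (by exact_mod_cast mem_fccSecondShellInt_of_sqNormInt)
      (by exact_mod_cast secondShellSquareInt_fcc) hw hw2 d
  · have hS : ∀ z ∈ hcpInt, sqNormInt z = ((18 : ℕ) : ℤ) := sqNormInt_hcpInt
    exact exists_hook_scaled (by norm_num) hS (by exact_mod_cast mem_hcpSecondShellInt_of_sqNormInt)
      (by exact_mod_cast secondShellSquareInt_hcp) hw hw2 d

/-- **Hook level** (the linear form used by DEV): if `−‖d‖ ≤ ⟪d,w⟫` then the hook has level `≥ min(⟪d,w⟫/2, ‖d‖/2) + ‖d‖/6`. [this file] -/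
theorem hook_level {d w c : EuclideanSpace ℝ (Fin 3)} (hlow : -‖d‖ ≤ ⟪d, w⟫)
    (h0 : 0 ≤ 2 * ⟪d, c⟫ - ⟪d, w⟫) (hsq : ‖d‖ ^ 2 - ⟪d, w⟫ ^ 2 / 2 ≤ (2 * ⟪d, c⟫ - ⟪d, w⟫) ^ 2) :
    min (⟪d, w⟫ / 2) (‖d‖ / 2) + ‖d‖ / 6 ≤ ⟪d, c⟫ := by
  have hD : 0 ≤ ‖d‖ := norm_nonneg d
  set D := ‖d‖ with hDdef
  set ℓ := ⟪d, w⟫ with hℓ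
  set x := ⟪d, c⟫ with hx
  by_cases hcase : ℓ ≤ D
  · -- `min = ℓ/2`; `(2x − ℓ)² ≥ D² − ℓ²/2 ≥ D²/2 ≥ (D/3)²`
    rw [min_eq_left (by linarith)]
    have hℓ2 : ℓ ^ 2 ≤ D ^ 2 := by nlinarith
    have h9 : (D / 3) ^ 2 ≤ (2 * x - ℓ) ^ 2 := by nlinarith
    have h10 : D / 3 ≤ 2 * x - ℓ := by
      nlinarith [sq_nonneg (2 * x - ℓ - D / 3), sq_nonneg (2 * x - ℓ + D / 3)]
    linarith
  · push Not at hcase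
    rw [min_eq_right (by linarith)]
    by_cases hbig : 4 * D ≤ 3 * ℓ
    · linarith
    · push Not at hbig
      -- `D ≤ ℓ < 4D/3`: `(2x − ℓ)² ≥ D² − ℓ²/2 ≥ (4D/3 − ℓ)²`
      have hpoly : (4 * D / 3 - ℓ) ^ 2 ≤ D ^ 2 - ℓ ^ 2 / 2 := by nlinarith [mul_nonneg (by linarith : 0 ≤ ℓ - D) (by linarith : 0 ≤ 4 * D / 3 - ℓ)]
      have h9 : (4 * D / 3 - ℓ) ^ 2 ≤ (2 * x - ℓ) ^ 2 := hpoly.trans hsq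
      have h10 : 4 * D / 3 - ℓ ≤ 2 * x - ℓ := by
        nlinarith [sq_nonneg (2 * x - ℓ - (4 * D / 3 - ℓ)), sq_nonneg (2 * x - ℓ + (4 * D / 3 - ℓ))]
      linarith

end Summit.AtomisticToContinuum.Crystallization.Theorems.OverbindingBudgetAffineFarSmoothSplit
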